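import Summits.NavierStokesRegularity.NavierStokesRegularity.Theorems.QuantisedSymmetryPolyhedralDssProfileExistsCellOfProfile
import HarnessLib

/-!
# Strategist sketch s21-g16 for crux `PolyhedralDssProfileExists` (stmt-NavierStokesRegularity-1404)

Independent strategy census, family `-s`, gen 16 (2026-08-29).  This file TYPES the best decomposition this
seat could produce (heading `## Decomposition` of `STRATEGY-CENSUS-s21.md`) and CERTIFIES why it has no teeth:

* `IsApproxCell G c K δ v` — a `δ`-approximate polyhedral cell: the body of the registered ∃-stub
  `stub_polyhedralCellExists` with the Oseen–Duhamel identity relaxed to a sup-norm residual `≤ δ`, the sup bound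
  and the `L⁴` bound of the datum made explicit (`≤ K`).
* `ApproxCellRung G c K x₀ κ δ` — ONE rung: for FIXED data `(G, c, K, x₀, κ)` a `δ`-approximate cell with the
  pointwise floor `κ ≤ ‖v(-1)(x₀)‖`.  For fixed data and fixed `δ > 0` this is a closed, finitely certifiable condition
  (validated numerics on a candidate) — the only strictly-sub-summit statements this seat found; no candidate exists.
* `ApproxCellFamily` (E1) — `∃ data, ∀ δ > 0, ApproxCellRung … δ`.
* `CellCompactness` (E2) — `∀ data`, rungs for every `δ > 0` ⇒ an exact nontrivial cell (a TRUE compactness lemma: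
  Arzelà–Ascoli for heat/Oseen potentials of uniformly bounded fields, the zoom junction transporting interior
  regularity to the initial slice, dominated convergence in the Duhamel identity, Fatou in `L⁴`; size L; not proved here).
* `crux_of_E1_E2 : ApproxCellFamily → CellCompactness → PolyhedralDssProfileExists` (kernel-checked, via the landed
  reduction `stub_profileOfPolyhedralCell`, p152884).
* `approxCellFamily_of_crux : PolyhedralDssProfileExists → ApproxCellFamily` (kernel-checked, via the landed
  `stub_cellOfProfile`): the converse is TRIVIAL, so once E2 lands, E1 ↔ crux (`approxCellFamily_iff_crux`).
  Verdict for the census: the split is formally admissible (k = 2, assembly proved, neither piece alone is the crux by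
  a cheap probe) but E1 is the crux's closure statement — all difficulty sits in E1; E2 is bookkeeping.  COSTUME.
-/

noncomputable section

namespace Summit.NavierStokesRegularity.NavierStokesRegularity.Cruxes.PolyhedralDssProfileExists.StrategistS21g16

open MeasureTheory Set Function Filter Topology
open Literature.Analysis.FluidPDE
open Summit.NavierStokesRegularity.NavierStokesRegularity.Theorems.PolyhedralDssProfileExists.PolyhedralCell

set_option linter.dupNamespace false

local notation "E³" => EuclideanSpace ℝ (Fin 3)

/-- A `δ`-approximate polyhedral `G`-cell with factor `c` and explicit bound `K`. -/
def IsApproxCell (G : Subgroup (E³ ≃ₗᵢ[ℝ] E³)) (c K δ : ℝ) (v : ℝ → E³ → E³) : Prop :=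
  ContinuousOn (Function.uncurry v) (Set.Icc (-1 : ℝ) (-(c ^ 2)⁻¹) ×ˢ Set.univ) ∧
  (∀ t ∈ Set.Icc (-1 : ℝ) (-(c ^ 2)⁻¹), ∀ x, ‖v t x‖ ≤ K) ∧
  (∀ t ∈ Set.Icc (-1 : ℝ) (-(c ^ 2)⁻¹), IsWeaklyDivFree (v t)) ∧
  (∀ s t : ℝ, -1 ≤ s → s < t → t ≤ -(c ^ 2)⁻¹ → ∀ x,
    ‖v t x - (heatFlow (v s) (t - s) x - oseenDuhamel 1 s v v t x)‖ ≤ δ) ∧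
  (∀ x, v (-(c ^ 2)⁻¹) x = c • v (-1) (c • x)) ∧
  (∀ g ∈ G, ∀ t ∈ Set.Icc (-1 : ℝ) (-(c ^ 2)⁻¹), ∀ x, v t (g x) = g (v t x)) ∧
  AEStronglyMeasurable (v (-1)) volume ∧ eLpNorm (v (-1)) 4 volume ≤ ENNReal.ofReal K

/-- ONE RUNG (fixed data, fixed residual level `δ`): finitely certifiable once a candidate exists. -/
def ApproxCellRung (G : Subgroup (E³ ≃ₗᵢ[ℝ] E³)) (c K : ℝ) (x₀ : E³) (κ δ : ℝ) : Prop :=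
  ∃ v : ℝ → E³ → E³, IsApproxCell G c K δ v ∧ κ ≤ ‖v (-1) x₀‖

/-- E1: a polyhedral sector, a factor and FIXED normalisation data carrying approximate cells of every accuracy. -/
def ApproxCellFamily : Prop :=
  ∃ G : Subgroup (E³ ≃ₗᵢ[ℝ] E³), Finite G ∧
    (∀ g ∈ G, LinearMap.det (g.toLinearEquiv : E³ →ₗ[ℝ] E³) = 1) ∧
    (∀ V : Submodule ℝ E³, (∀ g ∈ G, ∀ v ∈ V, g v ∈ V) → V = ⊥ ∨ V = ⊤) ∧
    ∃ c : ℝ, 1 < c ∧ ∃ K : ℝ, ∃ x₀ : E³, ∃ κ : ℝ, 0 < κ ∧ ∀ δ > 0, ApproxCellRung G c K x₀ κ δ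

/-- E2: compactness — approximate cells of every accuracy with fixed data yield an exact nontrivial cell. -/
def CellCompactness : Prop :=
  ∀ (G : Subgroup (E³ ≃ₗᵢ[ℝ] E³)) (c K : ℝ) (x₀ : E³) (κ : ℝ), 1 < c → 0 < κ →
    (∀ δ > 0, ApproxCellRung G c K x₀ κ δ) →
    ∃ v : ℝ → E³ → E³,
      (ContinuousOn (Function.uncurry v) (Set.Icc (-1 : ℝ) (-(c ^ 2)⁻¹) ×ˢ Set.univ) ∧
        (∃ M : ℝ, ∀ t ∈ Set.Icc (-1 : ℝ) (-(c ^ 2)⁻¹), ∀ x, ‖v t x‖ ≤ M) ∧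
        (∀ t ∈ Set.Icc (-1 : ℝ) (-(c ^ 2)⁻¹), IsWeaklyDivFree (v t)) ∧
        (∀ s t : ℝ, -1 ≤ s → s < t → t ≤ -(c ^ 2)⁻¹ → ∀ x,
          v t x = heatFlow (v s) (t - s) x - oseenDuhamel 1 s v v t x) ∧
        (∀ x, v (-(c ^ 2)⁻¹) x = c • v (-1) (c • x)) ∧
        (∀ g ∈ G, ∀ t ∈ Set.Icc (-1 : ℝ) (-(c ^ 2)⁻¹), ∀ x, v t (g x) = g (v t x))) ∧
      MemLp (v (-1)) 4 volume ∧ ¬ (v (-1) =ᵐ[volume] 0)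

/-- Assembly of the split: E1 → E2 → crux (kernel-checked; the seam is modus ponens + the landed reduction). -/
theorem crux_of_E1_E2 (h₁ : ApproxCellFamily) (h₂ : CellCompactness) :
    _root_.Summit.NavierStokesRegularity.NavierStokesRegularity.Theses.QuantisedSymmetry.PolyhedralDssProfileExists := by
  obtain ⟨G, hfin, hdet, hirr, c, hc, K, x₀, κ, hκ, hrungs⟩ := h₁
  obtain ⟨v, hcell, hL4, hnt⟩ := h₂ G c K x₀ κ hc hκ hrungs
  exact stub_profileOfPolyhedralCell ⟨G, hfin, hdet, hirr, c, hc, v, hcell, hL4, hnt⟩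

/-- The converse is trivial: an exact cell is a `δ`-approximate cell for every `δ > 0` (COSTUME certificate, part 1). -/
theorem approxCellFamily_of_crux
    (hX : _root_.Summit.NavierStokesRegularity.NavierStokesRegularity.Theses.QuantisedSymmetry.PolyhedralDssProfileExists) :
    ApproxCellFamily := by
  obtain ⟨G, hfin, hdet, hirr, c, hc, v, ⟨hcont, ⟨M, hM⟩, hdiv, hmild, hjunc, heqv⟩, hL4, hnt⟩ :=
    stub_cellOfProfile hX
  -- a point where the datum does not vanish
  have hx₀ : ∃ x₀ : E³, v (-1) x₀ ≠ 0 := by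
    by_contra h
    simp only [ne_eq, not_exists, not_not] at h
    apply hnt
    have : v (-1) = 0 := funext h
    rw [this]
  obtain ⟨x₀, hx₀⟩ := hx₀
  have hfin4 : eLpNorm (v (-1)) 4 volume ≠ ⊤ := hL4.eLpNorm_ne_top
  refine ⟨G, hfin, hdet, hirr, c, hc, max M (eLpNorm (v (-1)) 4 volume).toReal, x₀, ‖v (-1) x₀‖,
    norm_pos_iff.mpr hx₀, fun δ hδ => ⟨v, ⟨hcont, ?_, hdiv, ?_, hjunc, heqv, hL4.aestronglyMeasurable, ?_⟩, le_rfl⟩⟩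
  · intro t ht x
    exact (hM t ht x).trans (le_max_left _ _)
  · intro s t hs hst ht x
    rw [hmild s t hs hst ht x, sub_self, norm_zero]
    exact hδ.le
  · calc eLpNorm (v (-1)) 4 volume = ENNReal.ofReal (eLpNorm (v (-1)) 4 volume).toReal :=
          (ENNReal.ofReal_toReal hfin4).symm
      _ ≤ ENNReal.ofReal (max M (eLpNorm (v (-1)) 4 volume).toReal) :=
          ENNReal.ofReal_le_ofReal (le_max_right _ _)

/-- COSTUME certificate, part 2: modulo the (true, routine) compactness lemma E2, piece E1 IS the crux. -/
theorem approxCellFamily_iff_crux (h₂ : CellCompactness) :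
    ApproxCellFamily ↔
      _root_.Summit.NavierStokesRegularity.NavierStokesRegularity.Theses.QuantisedSymmetry.PolyhedralDssProfileExists :=
  ⟨fun h₁ => crux_of_E1_E2 h₁ h₂, approxCellFamily_of_crux⟩

/-- Ladder remark, typed: E1 hands out every rung; no finite set of rungs hands back E1 (the data are fixed
across rungs only inside E1's existential). -/
theorem rung_of_family (h₁ : ApproxCellFamily) :
    ∃ G : Subgroup (E³ ≃ₗᵢ[ℝ] E³), ∃ c K : ℝ, ∃ x₀ : E³, ∃ κ : ℝ, 0 < κ ∧ 1 < c ∧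
      ∀ δ > 0, ApproxCellRung G c K x₀ κ δ := by
  obtain ⟨G, -, -, -, c, hc, K, x₀, κ, hκ, h⟩ := h₁
  exact ⟨G, c, K, x₀, κ, hκ, hc, h⟩

end Summit.NavierStokesRegularity.NavierStokesRegularity.Cruxes.PolyhedralDssProfileExists.StrategistS21g16

end
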